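import Summits.ResolutionOfSingularities.ResolutionOfSingularities.Theorems.TameTwoStoreyLU7
import HarnessLib

/-!
# TameTwoStoreyLU8 — the located residual R30, the exact cuts `R29 ↔ R30 ↔ R28 ↔ R25 ↔ R23`, ROOT BY NAME `closes_tame2`

One of the landing files of the g29 node «TameTwoStorey» of the ROOT/RESIDUAL decomposition cell `decomp-res` (lens 1,
window (W-α) WHOLE; files `TameTwoStoreyLU`, `…LU1B`, `…LU2` (landed), `…LU3`–`…LU8`); see the module docstring of
`Summits.ResolutionOfSingularities.ResolutionOfSingularities.Theorems.TameTwoStoreyLU` for the thesis, the cell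
`TameOverInertLUAbove k O` (in `…LU2`), the law `relLU_of_tameOverInertLUAbove : TameOverInertLUAbove k O →
RelLocalUniformization k K O` (in `…LU7`), the paper instances and the sources.  This file: PART C — `NonKHToricArchLUKeyHenselDescentQuotTInertTwoCell` (`_holds`), R30 `NonKHToricArchLUKeyHenselDescentQuotTInertTwo` (docstring = the honest located remainder (α3′), (β), (γ)), `…TInertTwo_of_tinert` (R29 → R30), THE CUT `nonKHToricArchLUKeyHenselDescentQuotTInert_iff_tame2` (R29 ↔ R30), the re-locations `…334_iff_tame2`, `…QuotInert_iff_tame2` (R28), `…Quot_iff_tame2` (R25), `nonKHToricArchLUKeyHenselDescent_iff_tame2` (R23), `nonKHToricArchLU_iff_tame2`, `…Two_of_root`, `closes_tame2`, `root_iff_tame2_sigma`.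
Imports: `…TameTwoStoreyLU7`.  Problem side, sorry-free, hypothesis-free; every heavy theorem carries
`set_option maxHeartbeats … in` BEFORE its docstring — keep it.
-/

noncomputable section

open IsLocalRing Polynomial IntermediateField Literature.AlgebraicGeometry.Resolution
open Summit.ResolutionOfSingularities.ResolutionOfSingularities.Theorems.TameQuotientLU
open Summit.ResolutionOfSingularities.ResolutionOfSingularities.Theorems.TameAbelianQuotientLU
open Summit.ResolutionOfSingularities.ResolutionOfSingularities.Theorems.InertiaIsotypicStability
open Summit.ResolutionOfSingularities.ResolutionOfSingularities.Theorems.TameInertialLU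
open Summit.ResolutionOfSingularities.ResolutionOfSingularities.Theorems.TameAbelianMonomialChart

namespace Summit.ResolutionOfSingularities.ResolutionOfSingularities.Theorems.TameTwoStoreyLU

universe u


/-! ## PART C — the located residual `R30`, the exact cuts `R29 ↔ R30 ↔ R28 ↔ R25 ↔ R23`, ROOT BY NAME
`closes_tame2` -/

section CutT2

variable {k K : Type} [Field k] [Field K] [Algebra k K]

open Summit.ResolutionOfSingularities.ResolutionOfSingularities.Theses
open Summit.ResolutionOfSingularities.ResolutionOfSingularities.Theorems
open Summit.ResolutionOfSingularities.ResolutionOfSingularities.Theorems.KeyChainLU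
open Summit.ResolutionOfSingularities.ResolutionOfSingularities.Theorems.HenselKeyChainLU
open Summit.ResolutionOfSingularities.ResolutionOfSingularities.Theorems.GaloisDescentLU
open Summit.ResolutionOfSingularities.ResolutionOfSingularities.Theorems.PfaffLine
open Summit.ResolutionOfSingularities.ResolutionOfSingularities.Theorems.ToricLadder
open Summit.ResolutionOfSingularities.ResolutionOfSingularities.Theorems.KaplanskyLadder
open Summit.ResolutionOfSingularities.ResolutionOfSingularities.Theorems.PerronLadder
open Summit.ResolutionOfSingularities.ResolutionOfSingularities.Theorems.DefectlessLadder
open Summit.ResolutionOfSingularities.ResolutionOfSingularities.Theorems.WCut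
open Summit.ResolutionOfSingularities.ResolutionOfSingularities.Theorems.TameQuotientLU
open Summit.ResolutionOfSingularities.ResolutionOfSingularities.Theorems.DecompositionDescentLU
open Summit.ResolutionOfSingularities.ResolutionOfSingularities.Theorems.InertDescentLU
open Summit.ResolutionOfSingularities.ResolutionOfSingularities.Theorems.TameInertialLU

/-- The TWO-STOREY CELL PIECE of the residual family (tag DECIDED by `relLU_of_tameOverInertLUAbove`): R29's
binders together with the tame-over-inert two-storey cell give relative local uniformization. -/
def NonKHToricArchLUKeyHenselDescentQuotTInertTwoCell (e c n : ℕ) : Prop :=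
  ∀ p : ℕ, p.Prime → ∀ (k K : Type) [Field k] [CharP k p] [Field K] [Algebra k K],
    Algebra.trdeg k K ≤ n → ∀ O : ValuationSubring K, Nonempty O.valuation.RankOne →
    (∀ y ∈ O, ∃ f : Polynomial k, f ≠ 0 ∧ Polynomial.aeval y f ∈ O.nonunits) →
    ¬ IsAbhyankarPlace O (algebraMap k K).fieldRange ⊤ →
    ¬ (∃ d : ℕ, d < n ∧ SepDenseBelow k O d) → ¬ ToricDenseBelow k O e → ¬ KHTopBelow k O c →
    ¬ KeyChainTopBelow k O → ¬ HenselKeyChainTopBelow k O → ¬ GaloisHenselDescentDatum k O →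
    ¬ TameQuotientLU.TameEquivariantLUAbove k O →
    ¬ DecompositionFieldLUAbove k O → ¬ DecWitnessLUAbove k O → ¬ UnramifiedWitnessLUAbove k O →
    ¬ TameInertialLUAbove k O →
    TameOverInertLUAbove k O → RelLocalUniformization k K O

/-- THE TWO-STOREY LAW DECIDES THE CELL PIECE outright (no port, no fact binder, no section `H → G`). [folklore] -/
theorem nonKHToricArchLUKeyHenselDescentQuotTInertTwoCell_holds (e c n : ℕ) :
    NonKHToricArchLUKeyHenselDescentQuotTInertTwoCell e c n :=
  fun _ _ _ _ _ _ _ _ _ _ _ _ _ _ _ _ _ _ _ _ _ _ _ _ h2 => relLU_of_tameOverInertLUAbove h2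

/-- **NEW LOCATED RESIDUAL `R30`** (tag UNDECIDED · WEAKER than the root · located at `(e, c, n) = (3, 3, 4)`):
the located residual OFF the key-chain, Hensel, descent, tame-quotient, decomposition-descent, residue-free
witness, tame-inertial AND TAME-OVER-INERT TWO-STOREY cells — in addition to R29's clauses, for NO finite Galois
top `K′ | K` inside `K̄` (group `G`), no exponent `e ≥ 1` invertible in `k` with `μ_e ⊆ K′`, and no valuation ring
`O′` of `K′` above `O` which is `G`-STABLE (`G = G_Z`), whose INERTIA `T = {g | g ≡ id mod 𝔪_{O′}}` is ABELIAN of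
exponent `e`, and whose residue field is algebraic over `k`, do the finitely generated models `R` of `K` below `O`
embed — together with any prescribed finite `G`-stable `z ⊆ O′` — in `G`-stable models `R[t₀] ⊆ O′` regular at
the centre of `O′`.  KIND CONSUMED (hypothesis-free, by `relLU_of_tameOverInertLUAbove`): the whole TWO-STOREY
tame tower `K′ ⊇ K′^T ⊇ K` — an ARBITRARY finite inert storey `H = G/T` (non-abelian allowed; NO section `H → G`,
NO Schur–Zassenhaus complement, NO coprimality of `|H|` and `|T|`) on top of an abelian tame inertial storey `T`
of exponent `e ∈ k×` with `μ_e ⊆ K′`, for EVERY residue field `κ(O′)` algebraic over `k` (separability of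
`κ(O′) | κ(O)` is NOT assumed) — this subsumes g25/g26 (`G = H`, `T = 1`, resp. `G = T` cyclic/abelian with
`κ′ = κ`) and g28-B (`G = T` cyclic, `κ′ | k` algebraic) as the one-storey corners.  HONEST LOCATED REMAINDER:
(α3′) the SPLIT storey `G ⊋ G_Z(O′)` (several primes of `K′` above `O`, including the cyclotomic splitting case
`ζ_e ∉ K′` with `O′` split in `K′(ζ_e)`): composing the decomposition storey BELOW the two tame storeys is Door B
(decomposition descent, residuals R27/R28's cells consume its residue-free-witness corners only) — NOT consumed, NOT
claimed; (β) WILD ramification (`T` not of exponent prime to `p`, i.e. `G_W ≠ 1`; (W-wild) mod Theorem D); (γ) the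
DEFECT / immediate world ((K-D), (K-c)): tops `K′ | K` at which `O` has non-trivial defect, where no regular
`G`-stable model upstairs is supplied by the tame machinery; and, orthogonally, the PRODUCTION of the `G`-stable
regular models upstairs (the cell's model clause is an INPUT, as in every relative cell of this programme). -/
def NonKHToricArchLUKeyHenselDescentQuotTInertTwo (e c n : ℕ) : Prop :=
  ∀ p : ℕ, p.Prime → ∀ (k K : Type) [Field k] [CharP k p] [Field K] [Algebra k K],
    Algebra.trdeg k K ≤ n → ∀ O : ValuationSubring K, Nonempty O.valuation.RankOne →
    (∀ y ∈ O, ∃ f : Polynomial k, f ≠ 0 ∧ Polynomial.aeval y f ∈ O.nonunits) →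
    ¬ IsAbhyankarPlace O (algebraMap k K).fieldRange ⊤ →
    ¬ (∃ d : ℕ, d < n ∧ SepDenseBelow k O d) → ¬ ToricDenseBelow k O e → ¬ KHTopBelow k O c →
    ¬ KeyChainTopBelow k O → ¬ HenselKeyChainTopBelow k O → ¬ GaloisHenselDescentDatum k O →
    ¬ TameQuotientLU.TameEquivariantLUAbove k O →
    ¬ DecompositionFieldLUAbove k O → ¬ DecWitnessLUAbove k O → ¬ UnramifiedWitnessLUAbove k O →
    ¬ TameInertialLUAbove k O →
    ¬ TameOverInertLUAbove k O → RelLocalUniformization k K O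

/-- Dropping the negated two-storey hypothesis: `R29 → R30`. [folklore] -/
theorem nonKHToricArchLUKeyHenselDescentQuotTInertTwo_of_tinert {e c n : ℕ}
    (h : NonKHToricArchLUKeyHenselDescentQuotTInert e c n) :
    NonKHToricArchLUKeyHenselDescentQuotTInertTwo e c n :=
  fun p hp k K _ _ _ _ hd O h1 h0 hA hnd hnt hnk hkey hH hG hT hDF hDW hU hI _ =>
    h p hp k K hd O h1 h0 hA hnd hnt hnk hkey hH hG hT hDF hDW hU hI

/-- **THE TWO-STOREY CUT** (kernel, exact, hypothesis-free): the g28 located residual `R29` is EQUIVALENT to its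
part off the tame-over-inert two-storey cell — on the cell the law `relLU_of_tameOverInertLUAbove` decides.
[folklore] -/
theorem nonKHToricArchLUKeyHenselDescentQuotTInert_iff_tame2 {e c n : ℕ} :
    NonKHToricArchLUKeyHenselDescentQuotTInert e c n ↔ NonKHToricArchLUKeyHenselDescentQuotTInertTwo e c n := by
  refine ⟨nonKHToricArchLUKeyHenselDescentQuotTInertTwo_of_tinert,
    fun h p hp k K _ _ _ _ hd O hr hz hA hnd hnt hnk hkey hH hG hT hDF hDW hU hI => ?_⟩
  by_cases h2 : TameOverInertLUAbove k O
  · exact relLU_of_tameOverInertLUAbove h2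
  exact h p hp k K hd O hr hz hA hnd hnt hnk hkey hH hG hT hDF hDW hU hI h2

/-- The EXACT re-location at the programme's parameters `(3, 3, 4)` (`R29 ↔ R30`, hypothesis-free). [folklore] -/
theorem nonKHToricArchLUKeyHenselDescentQuotTInert334_iff_tame2 :
    NonKHToricArchLUKeyHenselDescentQuotTInert 3 3 4 ↔ NonKHToricArchLUKeyHenselDescentQuotTInertTwo 3 3 4 :=
  nonKHToricArchLUKeyHenselDescentQuotTInert_iff_tame2

/-- The g28 located residual `R28` re-located in one step (`R28 ↔ R30`). [folklore] -/
theorem nonKHToricArchLUKeyHenselDescentQuotInert_iff_tame2 {e c n : ℕ} :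
    NonKHToricArchLUKeyHenselDescentQuotInert e c n ↔ NonKHToricArchLUKeyHenselDescentQuotTInertTwo e c n :=
  nonKHToricArchLUKeyHenselDescentQuotInert_iff_tinert.trans nonKHToricArchLUKeyHenselDescentQuotTInert_iff_tame2

/-- The g25 located residual re-located (`R25 ↔ R30`). [folklore] -/
theorem nonKHToricArchLUKeyHenselDescentQuot_iff_tame2 {e c n : ℕ} :
    NonKHToricArchLUKeyHenselDescentQuot e c n ↔ NonKHToricArchLUKeyHenselDescentQuotTInertTwo e c n :=
  nonKHToricArchLUKeyHenselDescentQuot_iff_tinert.trans nonKHToricArchLUKeyHenselDescentQuotTInert_iff_tame2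

/-- The g23 located residual re-located (`R23 ↔ R30`). [folklore] -/
theorem nonKHToricArchLUKeyHenselDescent_iff_tame2 {e c n : ℕ} :
    NonKHToricArchLUKeyHenselDescent e c n ↔ NonKHToricArchLUKeyHenselDescentQuotTInertTwo e c n :=
  nonKHToricArchLUKeyHenselDescent_iff_tinert.trans nonKHToricArchLUKeyHenselDescentQuotTInert_iff_tame2

/-- The TRUE residual family of g17/g20 (`NonKHToricArchLU`) re-located off all eight cells. [folklore] -/
theorem nonKHToricArchLU_iff_tame2 {e c n : ℕ} :
    NonKHToricArchLU e c n ↔ NonKHToricArchLUKeyHenselDescentQuotTInertTwo e c n :=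
  nonKHToricArchLU_iff_tinert.trans nonKHToricArchLUKeyHenselDescentQuotTInert_iff_tame2

/-- The new residual follows from the root outright (it is a WEAKER piece). [folklore] -/
theorem nonKHToricArchLUKeyHenselDescentQuotTInertTwo_of_root (hS : _root_.ResolutionOfSingularities)
    (e c n : ℕ) : NonKHToricArchLUKeyHenselDescentQuotTInertTwo e c n :=
  nonKHToricArchLUKeyHenselDescentQuotTInertTwo_of_tinert (nonKHToricArchLUKeyHenselDescentQuotTInert_of_root hS e c n)

/-- **`closes_tame2` — ROOT BY NAME (binders PRINTED):** `(hCP : CossartPiltant2019LU3)` the Cossart–Piltant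
dimension-3 floor (print) · `(hCJS : CossartJannsenSaito2020Embedded)` embedded resolution of excellent surfaces
(named fact) · `(hAsc : KK05NCVAscent)` the Knaf–Kuhlmann (NC)+(V) ascent Π₁ (print) · `(hN : ∀ d ≥ 4, R30 3 3 d)`
the located residual OFF the key-chain, Hensel, descent, tame-quotient, decomposition-descent, residue-free
witness, tame-inertial AND two-storey cells · `(h₃ : Valuative.PatchingRel)` the patching crux 0642 ⇒
`ResolutionOfSingularities`.  All eight cells are discharged INSIDE the kernel. [folklore] -/
theorem closes_tame2 (hCP : CossartPiltant2019LU3.{0}) (hCJS : CossartJannsenSaito2020Embedded.{0})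
    (hAsc : KK05NCVAscent) (hN : ∀ d, 4 ≤ d → NonKHToricArchLUKeyHenselDescentQuotTInertTwo 3 3 d)
    (h₃ : Valuative.PatchingRel) : _root_.ResolutionOfSingularities :=
  closes_tinert hCP hCJS hAsc (fun d hd => nonKHToricArchLUKeyHenselDescentQuotTInert_iff_tame2.2 (hN d hd)) h₃

/-- Root-level summary: modulo floor + CJS + Π₁ + 0642 the ROOT is EQUIVALENT to the residual family off the eight
cells. [folklore] -/
theorem root_iff_tame2_sigma (hCP : CossartPiltant2019LU3.{0})
    (hCJS : CossartJannsenSaito2020Embedded.{0}) (hAsc : KK05NCVAscent) (h₃ : Valuative.PatchingRel) :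
    _root_.ResolutionOfSingularities ↔ ∀ d, 4 ≤ d → NonKHToricArchLUKeyHenselDescentQuotTInertTwo 3 3 d := by
  rw [root_iff_tinert_sigma hCP hCJS hAsc h₃]
  exact forall₂_congr fun d _ => nonKHToricArchLUKeyHenselDescentQuotTInert_iff_tame2

end CutT2

end Summit.ResolutionOfSingularities.ResolutionOfSingularities.Theorems.TameTwoStoreyLU

end
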